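import Mathlib.Geometry.Euclidean.Inversion.Calculus
import Mathlib.MeasureTheory.Function.Jacobian
import Mathlib.MeasureTheory.Measure.Haar.NormedSpace
import Mathlib.MeasureTheory.Measure.Haar.InnerProductSpace
import Mathlib.MeasureTheory.Group.Integral
import HarnessLib

/-!
# The two-point Wente knit: from the one-centre bound and inversion invariance to the oscillation bound

Helper (def-free) for ROAD (W) of crux `stmt-QuantumFields-23533` (`Summit.QuantumFields.YangMills.Theses.PoincareLipschitz…`
S1″ / the (GAP) socket), memo `ROAD-W-WENTE-3PI-w3g16.md` §2 (W-TWO), brick table §3 row «W-TWO».  The road proves the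
H-system energy gap at `3π` from the SHARP TWO-POINT Wente bound `|ū x₀ − ū x₁| ≤ (1/π)‖∇a‖₂‖∇b‖₂`; this file is the
KNIT that turns

* (ONE) the one-centre package (bricks W-ONE (a)(b)(c)): every member `v` of the class has a CONTINUOUS representative `v̄`,
  `v̄ = v` a.e., whose SMOOTH ANNULAR AVERAGES `(πR²)⁻¹∫Ψ(‖y − x₀‖²/R²) v̄(y) dy` about any centre `x₀` converge as `R → ∞` to some `L`
  with `|v̄ x₀ − L| ≤ K` (the profile `Ψ` — continuous, vanishing off `(1/4,1)`, planar mass `π` — is the W-ONE pen's letter), and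
* (INV) inversion invariance of the class about every centre (brick W-INV composed with W-ONE (d)),

into the two-point bound `|ū x₀ − ū x₁| ≤ K` for ALL `x₀, x₁`, and then into the oscillation form `∃ c, |u − c| ≤ K/2` a.e.
that brick W-ALG consumes (`K = (1/π)‖∇a‖₂‖∇b‖₂` there).  The class is an ABSTRACT predicate `adm : (E² → ℝ) → Prop` — the
W-ONE / W-INV pens instantiate it with «`v` is the first entry of an admissible triple `(v; p, q)`»; nothing about weak
derivatives is used here.  Ingredients: the inversion `EuclideanGeometry.inversion x₁ 1` is a smooth involution of `{x₁}ᶜ`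
carrying null sets to null sets (Mathlib `addHaar_image_eq_zero_of_differentiableOn_of_addHaar_eq_zero`), continuous
a.e.-equal functions agree on open sets (`Measure.eqOn_open_of_ae_eq`), and large annuli about `y₀` are mapped by the
inversion uniformly close to the centre `x₁` (`dist (inversion x₁ 1 y) x₁ = (dist y x₁)⁻¹`), so the annular averages of
`ū ∘ inversion` at large scale converge to `ū x₁` (mass one by the Haar scaling `dy = R² dz`, kernel `L¹`-bounded).

HONEST: soft analysis over abstract rows (ONE)/(INV); proves nothing of (W-OSC) unconditionally, nor (GAP)/(TM)/S1″/K1/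
`BlockLipschitzL`/`HistoryTailL`; rung R3 = YM₃ on T³ — NOT d = 4, NOT infinite volume, NOT a mass gap, NOT Clay.
-/

set_option autoImplicit false

noncomputable section

namespace Summit.QuantumFields.YangMills.Theorems.PoincareLipschitzWenteTwoPoint

open MeasureTheory Filter Set Function EuclideanGeometry
open scoped Real Topology

/-! ## §1 The unit inversion about `x₁`: letters -/

/-- The unit inversion fixes only its centre. [folklore] -/
theorem inversion_ne_center {x₁ x : (EuclideanSpace ℝ (Fin 2))} (hx : x ≠ x₁) : inversion x₁ 1 x ≠ x₁ := by
  intro h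
  exact hx ((inversion_eq_center one_ne_zero).mp h)

/-- The unit inversion is an involution of the plane. [folklore] -/
theorem inversion_inversion_one (x₁ x : (EuclideanSpace ℝ (Fin 2))) : inversion x₁ 1 (inversion x₁ 1 x) = x :=
  inversion_involutive x₁ one_ne_zero x

/-- Distance to the centre after the unit inversion is the inverse distance. [folklore] -/
theorem dist_inversion_one (x₁ x : (EuclideanSpace ℝ (Fin 2))) : dist (inversion x₁ 1 x) x₁ = (dist x x₁)⁻¹ := by
  rw [dist_inversion_center, one_pow, one_div]

/-- The unit inversion is smooth at every point other than its centre. [folklore] -/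
theorem contDiffAt_inversion_one {x₁ x : (EuclideanSpace ℝ (Fin 2))} (hx : x ≠ x₁) {n : ℕ∞} :
    ContDiffAt ℝ n (fun y : (EuclideanSpace ℝ (Fin 2)) => inversion x₁ 1 y) x :=
  ContDiffAt.inversion (c := fun _ => x₁) (R := fun _ => (1 : ℝ)) (x := id)
    contDiffAt_const contDiffAt_const contDiffAt_id hx

/-- The unit inversion is continuous off its centre. [folklore] -/
theorem continuousOn_inversion_one (x₁ : (EuclideanSpace ℝ (Fin 2))) : ContinuousOn (fun y : (EuclideanSpace ℝ (Fin 2)) => inversion x₁ 1 y) {x₁}ᶜ :=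
  fun _ hx => (contDiffAt_inversion_one (n := 1) hx).continuousAt.continuousWithinAt

/-- The unit inversion is differentiable off its centre. [folklore] -/
theorem differentiableOn_inversion_one (x₁ : (EuclideanSpace ℝ (Fin 2))) :
    DifferentiableOn ℝ (fun y : (EuclideanSpace ℝ (Fin 2)) => inversion x₁ 1 y) {x₁}ᶜ :=
  fun _ hx => ((contDiffAt_inversion_one (n := 1) hx).differentiableAt one_ne_zero).differentiableWithinAt

/-- **Null sets pull back to null sets under the unit inversion**: an a.e. property transfers along `y ↦ inversion x₁ 1 y`
(the inversion is a differentiable involution of `{x₁}ᶜ`, so the exceptional preimage is the differentiable image of a null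
set plus the centre). [folklore] -/
theorem ae_comp_inversion_one (x₁ : (EuclideanSpace ℝ (Fin 2))) {p : (EuclideanSpace ℝ (Fin 2)) → Prop} (h : ∀ᵐ x ∂(volume : Measure (EuclideanSpace ℝ (Fin 2))), p x) :
    ∀ᵐ y ∂(volume : Measure (EuclideanSpace ℝ (Fin 2))), p (inversion x₁ 1 y) := by
  rw [ae_iff] at h ⊢
  have hsub : {y : (EuclideanSpace ℝ (Fin 2)) | ¬ p (inversion x₁ 1 y)}
      ⊆ (fun y : (EuclideanSpace ℝ (Fin 2)) => inversion x₁ 1 y) '' ({x | ¬ p x} ∩ {x₁}ᶜ) ∪ {x₁} := by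
    intro y hy
    by_cases hyx : y = x₁
    · exact Or.inr hyx
    · refine Or.inl ⟨inversion x₁ 1 y, ⟨hy, ?_⟩, inversion_inversion_one x₁ y⟩
      exact inversion_ne_center hyx
  refine measure_mono_null hsub (measure_union_null ?_ (measure_singleton x₁))
  exact addHaar_image_eq_zero_of_differentiableOn_of_addHaar_eq_zero volume
    ((differentiableOn_inversion_one x₁).mono inter_subset_right) (measure_mono_null inter_subset_left h)

/-- A.e. equality transfers along the unit inversion. [folklore] -/
theorem ae_eq_comp_inversion_one (x₁ : (EuclideanSpace ℝ (Fin 2))) {f g : (EuclideanSpace ℝ (Fin 2)) → ℝ} (h : f =ᵐ[volume] g) :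
    (f ∘ fun y => inversion x₁ 1 y) =ᵐ[volume] (g ∘ fun y => inversion x₁ 1 y) :=
  ae_comp_inversion_one x₁ (p := fun x => f x = g x) h

/-- **Identification off the centre**: a continuous function a.e. equal to `ū ∘ inversion` with `ū` continuous coincides
with it at every point other than the centre. [folklore] -/
theorem eq_comp_inversion_of_ae_eq {x₁ : (EuclideanSpace ℝ (Fin 2))} {w ū : (EuclideanSpace ℝ (Fin 2)) → ℝ} (hw : Continuous w) (hū : Continuous ū)
    (hae : w =ᵐ[volume] (ū ∘ fun y => inversion x₁ 1 y)) {y : (EuclideanSpace ℝ (Fin 2))} (hy : y ≠ x₁) :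
    w y = ū (inversion x₁ 1 y) := by
  have hopen : IsOpen ({x₁}ᶜ : Set (EuclideanSpace ℝ (Fin 2))) := isOpen_compl_singleton
  have heq : EqOn w (ū ∘ fun y => inversion x₁ 1 y) {x₁}ᶜ :=
    Measure.eqOn_open_of_ae_eq (ae_restrict_of_ae hae) hopen hw.continuousOn
      (hū.comp_continuousOn (continuousOn_inversion_one x₁))
  exact heq hy

/-! ## §2 Smooth annular averages: scaling, mass one, and the bound near a limit value -/

/-- Rescaling inside the kernel: `‖R⁻¹ • v‖² = ‖v‖²/R²`. [folklore] -/
theorem norm_inv_smul_sq (v : (EuclideanSpace ℝ (Fin 2))) {R : ℝ} (hR : 0 < R) : ‖R⁻¹ • v‖ ^ 2 = ‖v‖ ^ 2 / R ^ 2 := by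
  rw [norm_smul, Real.norm_eq_abs, abs_inv, abs_of_pos hR, mul_pow, inv_pow]
  ring

/-- **Scaling of the rescaled kernel** (translation invariance and the Haar scaling `dy = R² dz` in the plane):
`∫ Φ(‖y − x₀‖²/R²) dy = R² ∫ Φ(‖z‖²) dz` for every `Φ : ℝ → ℝ`. [folklore] -/
theorem integral_kernel_rescaled (Φ : ℝ → ℝ) (x₀ : (EuclideanSpace ℝ (Fin 2))) {R : ℝ} (hR : 0 < R) :
    ∫ y : (EuclideanSpace ℝ (Fin 2)), Φ (‖y - x₀‖ ^ 2 / R ^ 2) = R ^ 2 * ∫ z : (EuclideanSpace ℝ (Fin 2)), Φ (‖z‖ ^ 2) := by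
  have h1 : (fun y : (EuclideanSpace ℝ (Fin 2)) => Φ (‖y - x₀‖ ^ 2 / R ^ 2))
      = fun y : (EuclideanSpace ℝ (Fin 2)) => (fun z : (EuclideanSpace ℝ (Fin 2)) => Φ (‖R⁻¹ • z‖ ^ 2)) (y - x₀) := by
    funext y
    simp only [norm_inv_smul_sq (y - x₀) hR]
  rw [h1, integral_sub_right_eq_self (fun z : (EuclideanSpace ℝ (Fin 2)) => Φ (‖R⁻¹ • z‖ ^ 2)) x₀,
    Measure.integral_comp_inv_smul_of_nonneg volume (fun z : (EuclideanSpace ℝ (Fin 2)) => Φ (‖z‖ ^ 2)) hR.le,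
    finrank_euclideanSpace_fin, smul_eq_mul]

/-- **Mass one**: with `∫ Ψ(‖z‖²) dz = π`, the normalised rescaled kernel has total mass `1` about every centre and at every
scale `R > 0`. [folklore] -/
theorem annularKernel_mass_one (Ψ : ℝ → ℝ) (hΨπ : ∫ z : (EuclideanSpace ℝ (Fin 2)), Ψ (‖z‖ ^ 2) = π) (x₀ : (EuclideanSpace ℝ (Fin 2))) {R : ℝ} (hR : 0 < R) :
    (π * R ^ 2)⁻¹ * ∫ y : (EuclideanSpace ℝ (Fin 2)), Ψ (‖y - x₀‖ ^ 2 / R ^ 2) = 1 := by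
  rw [integral_kernel_rescaled Ψ x₀ hR, hΨπ]
  have : π * R ^ 2 ≠ 0 := by positivity
  field_simp

/-- A continuous profile vanishing for `t ≥ 1` gives a continuous compactly supported planar kernel `z ↦ Φ(‖z‖²)`, hence an
integrable one. [folklore] -/
theorem integrable_kernel {Φ : ℝ → ℝ} (hΦc : Continuous Φ) (hΦ0 : ∀ t, 1 ≤ t → Φ t = 0) :
    Integrable (fun z : (EuclideanSpace ℝ (Fin 2)) => Φ (‖z‖ ^ 2)) := by
  have hc : Continuous fun z : (EuclideanSpace ℝ (Fin 2)) => Φ (‖z‖ ^ 2) := hΦc.comp (continuous_norm.pow 2)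
  refine hc.integrable_of_hasCompactSupport ?_
  refine HasCompactSupport.intro (isCompact_closedBall (0 : (EuclideanSpace ℝ (Fin 2))) 1) (fun z hz => ?_)
  apply hΦ0
  rw [Metric.mem_closedBall, dist_zero_right, not_le] at hz
  nlinarith [norm_nonneg z]

/-- The rescaled kernel times a continuous function is integrable (continuous with compact support). [folklore] -/
theorem integrable_kernel_rescaled_mul {Φ : ℝ → ℝ} (hΦc : Continuous Φ) (hΦ0 : ∀ t, 1 ≤ t → Φ t = 0)
    {w : (EuclideanSpace ℝ (Fin 2)) → ℝ} (hw : Continuous w) (x₀ : (EuclideanSpace ℝ (Fin 2))) {R : ℝ} (hR : 0 < R) :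
    Integrable (fun y : (EuclideanSpace ℝ (Fin 2)) => Φ (‖y - x₀‖ ^ 2 / R ^ 2) * w y) := by
  have hc : Continuous fun y : (EuclideanSpace ℝ (Fin 2)) => Φ (‖y - x₀‖ ^ 2 / R ^ 2) * w y :=
    ((hΦc.comp (((continuous_id.sub continuous_const).norm.pow 2).div_const _)).mul hw)
  refine hc.integrable_of_hasCompactSupport ?_
  refine HasCompactSupport.intro (isCompact_closedBall x₀ R) (fun y hy => ?_)
  rw [Metric.mem_closedBall, dist_eq_norm, not_le] at hy
  have h1 : 1 ≤ ‖y - x₀‖ ^ 2 / R ^ 2 := by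
    rw [le_div_iff₀ (by positivity), one_mul]
    nlinarith [norm_nonneg (y - x₀)]
  rw [hΦ0 _ h1, zero_mul]

/-- Where the annular profile does not vanish, the point lies in the annulus `R/2 < ‖y − x₀‖ < R`. [folklore] -/
theorem mem_annulus_of_ne_zero {Ψ : ℝ → ℝ} (hΨ0 : ∀ t, t ≤ 1 / 4 ∨ 1 ≤ t → Ψ t = 0) {x₀ y : (EuclideanSpace ℝ (Fin 2))} {R : ℝ}
    (hR : 0 < R) (h : Ψ (‖y - x₀‖ ^ 2 / R ^ 2) ≠ 0) : R / 2 < ‖y - x₀‖ ∧ ‖y - x₀‖ < R := by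
  have ht : ¬ (‖y - x₀‖ ^ 2 / R ^ 2 ≤ 1 / 4 ∨ 1 ≤ ‖y - x₀‖ ^ 2 / R ^ 2) := fun h' => h (hΨ0 _ h')
  simp only [not_or, not_le] at ht
  obtain ⟨h1, h2⟩ := ht
  have hR2 : 0 < R ^ 2 := by positivity
  rw [lt_div_iff₀ hR2] at h1
  rw [div_lt_iff₀ hR2, one_mul] at h2
  have hn : 0 ≤ ‖y - x₀‖ := norm_nonneg _
  constructor
  · nlinarith
  · nlinarith

/-- **The bound near a limit value**: if `|w − c| ≤ ε` on the annulus `R/2 ≤ ‖y − x₀‖ ≤ R`, then the smooth annular average of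
`w` at scale `R` is within `ε·π⁻¹∫|Ψ(‖z‖²)|` of `c`. [folklore] -/
theorem abs_annularAvg_sub_le (Ψ : ℝ → ℝ) (hΨc : Continuous Ψ) (hΨ0 : ∀ t, t ≤ 1 / 4 ∨ 1 ≤ t → Ψ t = 0)
    (hΨπ : ∫ z : (EuclideanSpace ℝ (Fin 2)), Ψ (‖z‖ ^ 2) = π) {w : (EuclideanSpace ℝ (Fin 2)) → ℝ} (hw : Continuous w) (x₀ : (EuclideanSpace ℝ (Fin 2))) {R : ℝ} (hR : 0 < R)
    {c ε : ℝ} (hclose : ∀ y : (EuclideanSpace ℝ (Fin 2)), R / 2 ≤ ‖y - x₀‖ → ‖y - x₀‖ ≤ R → |w y - c| ≤ ε) :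
    |(π * R ^ 2)⁻¹ * (∫ y : (EuclideanSpace ℝ (Fin 2)), Ψ (‖y - x₀‖ ^ 2 / R ^ 2) * w y) - c|
      ≤ ε * (π⁻¹ * ∫ z : (EuclideanSpace ℝ (Fin 2)), |Ψ (‖z‖ ^ 2)|) := by
  have hΨ1 : ∀ t, 1 ≤ t → Ψ t = 0 := fun t ht => hΨ0 t (Or.inr ht)
  have hmass := annularKernel_mass_one Ψ hΨπ x₀ hR
  have hi_w := integrable_kernel_rescaled_mul hΨc hΨ1 hw x₀ hR
  have hi_c := integrable_kernel_rescaled_mul hΨc hΨ1 (continuous_const (y := c)) x₀ hR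
  -- rewrite `c` as the average of the constant function
  have hc : c = (π * R ^ 2)⁻¹ * ∫ y : (EuclideanSpace ℝ (Fin 2)), Ψ (‖y - x₀‖ ^ 2 / R ^ 2) * c := by
    rw [integral_mul_const, ← mul_assoc, hmass, one_mul]
  have hdiff : (π * R ^ 2)⁻¹ * (∫ y : (EuclideanSpace ℝ (Fin 2)), Ψ (‖y - x₀‖ ^ 2 / R ^ 2) * w y) - c
      = (π * R ^ 2)⁻¹ * ∫ y : (EuclideanSpace ℝ (Fin 2)), Ψ (‖y - x₀‖ ^ 2 / R ^ 2) * (w y - c) := by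
    conv_lhs => rw [hc]
    rw [← mul_sub, ← integral_sub hi_w hi_c]
    congr 1
    refine integral_congr_ae (Eventually.of_forall fun y => ?_)
    simp only
    ring
  rw [hdiff, abs_mul, abs_inv, abs_of_pos (by positivity : 0 < π * R ^ 2)]
  -- pointwise bound of the integrand
  have hpt : ∀ y : (EuclideanSpace ℝ (Fin 2)), |Ψ (‖y - x₀‖ ^ 2 / R ^ 2) * (w y - c)| ≤ |Ψ (‖y - x₀‖ ^ 2 / R ^ 2)| * ε := by
    intro y
    rw [abs_mul]
    by_cases hz : Ψ (‖y - x₀‖ ^ 2 / R ^ 2) = 0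
    · rw [hz, abs_zero, zero_mul, zero_mul]
    · obtain ⟨h1, h2⟩ := mem_annulus_of_ne_zero hΨ0 hR hz
      exact mul_le_mul_of_nonneg_left (hclose y h1.le h2.le) (abs_nonneg _)
  have hi_abs : Integrable (fun y : (EuclideanSpace ℝ (Fin 2)) => |Ψ (‖y - x₀‖ ^ 2 / R ^ 2)| * ε) := by
    have := integrable_kernel_rescaled_mul (Φ := fun t => |Ψ t|) (continuous_abs.comp hΨc)
      (fun t ht => by simp only [hΨ1 t ht, abs_zero]) (continuous_const (y := ε)) x₀ hR
    exact this
  have hint : |∫ y : (EuclideanSpace ℝ (Fin 2)), Ψ (‖y - x₀‖ ^ 2 / R ^ 2) * (w y - c)| ≤ ∫ y : (EuclideanSpace ℝ (Fin 2)), |Ψ (‖y - x₀‖ ^ 2 / R ^ 2)| * ε := by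
    refine (abs_integral_le_integral_abs).trans (integral_mono_of_nonneg ?_ hi_abs ?_)
    · exact Eventually.of_forall fun y => abs_nonneg _
    · exact Eventually.of_forall hpt
  rw [integral_mul_const, integral_kernel_rescaled (fun t => |Ψ t|) x₀ hR] at hint
  calc (π * R ^ 2)⁻¹ * |∫ y : (EuclideanSpace ℝ (Fin 2)), Ψ (‖y - x₀‖ ^ 2 / R ^ 2) * (w y - c)|
      ≤ (π * R ^ 2)⁻¹ * (R ^ 2 * (∫ z : (EuclideanSpace ℝ (Fin 2)), |Ψ (‖z‖ ^ 2)|) * ε) :=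
        mul_le_mul_of_nonneg_left hint (by positivity)
    _ = ε * (π⁻¹ * ∫ z : (EuclideanSpace ℝ (Fin 2)), |Ψ (‖z‖ ^ 2)|) := by
        have : R ^ 2 ≠ 0 := by positivity
        field_simp

/-! ## §3 Annular averages of `ū ∘ inversion` about `y₀` converge to `ū x₁` at infinity -/

/-- A point at distance at least `R/2` from `y₀` is at distance at least `R/2 − dist y₀ x₁` from `x₁`. [folklore] -/
theorem sub_dist_le_dist_of_le_norm_sub (y₀ x₁ y : (EuclideanSpace ℝ (Fin 2))) {R : ℝ} (hy : R / 2 ≤ ‖y - y₀‖) :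
    R / 2 - dist y₀ x₁ ≤ dist y x₁ := by
  have h1 : ‖y - y₀‖ ≤ ‖y - x₁‖ + ‖y₀ - x₁‖ := by
    calc ‖y - y₀‖ = ‖(y - x₁) - (y₀ - x₁)‖ := by congr 1; abel
      _ ≤ ‖y - x₁‖ + ‖y₀ - x₁‖ := norm_sub_le _ _
  rw [dist_eq_norm, dist_eq_norm]
  linarith

/-- **Annular averages at infinity**: if `w` is continuous and coincides with `ū ∘ inversion x₁ 1` off the centre, with `ū`
continuous, then the smooth annular averages of `w` about any `y₀` converge to `ū x₁` as the scale tends to infinity (the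
annulus `R/2 ≤ ‖y − y₀‖ ≤ R` is inverted into the ball of radius `(R/2 − dist y₀ x₁)⁻¹` about `x₁`). [folklore] -/
theorem tendsto_annularAvg_comp_inversion (Ψ : ℝ → ℝ) (hΨc : Continuous Ψ)
    (hΨ0 : ∀ t, t ≤ 1 / 4 ∨ 1 ≤ t → Ψ t = 0) (hΨπ : ∫ z : (EuclideanSpace ℝ (Fin 2)), Ψ (‖z‖ ^ 2) = π)
    {w ū : (EuclideanSpace ℝ (Fin 2)) → ℝ} (hw : Continuous w) (hū : Continuous ū) (y₀ x₁ : (EuclideanSpace ℝ (Fin 2)))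
    (heq : ∀ y : (EuclideanSpace ℝ (Fin 2)), y ≠ x₁ → w y = ū (inversion x₁ 1 y)) :
    Tendsto (fun R : ℝ => (π * R ^ 2)⁻¹ * ∫ y : (EuclideanSpace ℝ (Fin 2)), Ψ (‖y - y₀‖ ^ 2 / R ^ 2) * w y) atTop (𝓝 (ū x₁)) := by
  set C : ℝ := π⁻¹ * ∫ z : (EuclideanSpace ℝ (Fin 2)), |Ψ (‖z‖ ^ 2)| with hC
  have hC0 : 0 ≤ C := mul_nonneg (inv_nonneg.mpr Real.pi_pos.le) (integral_nonneg fun _ => abs_nonneg _)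
  rw [Metric.tendsto_atTop]
  intro ε hε
  have hε' : 0 < ε / (C + 1) := div_pos hε (by linarith)
  obtain ⟨δ, hδ, hδε⟩ := Metric.continuous_iff.mp hū x₁ (ε / (C + 1)) hε'
  refine ⟨2 * (dist y₀ x₁ + δ⁻¹ + 1), fun R hR => ?_⟩
  have hδi : 0 < δ⁻¹ := inv_pos.mpr hδ
  have hRpos : 0 < R := by linarith [dist_nonneg (x := y₀) (y := x₁)]
  have hclose : ∀ y : (EuclideanSpace ℝ (Fin 2)), R / 2 ≤ ‖y - y₀‖ → ‖y - y₀‖ ≤ R → |w y - ū x₁| ≤ ε / (C + 1) := by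
    intro y hy _
    have hfar : δ⁻¹ < dist y x₁ := by
      have := sub_dist_le_dist_of_le_norm_sub y₀ x₁ y hy
      linarith
    have hyx : y ≠ x₁ := by
      intro h; rw [h, dist_self] at hfar; linarith
    rw [heq y hyx, ← Real.dist_eq]
    refine (hδε _ ?_).le
    rw [dist_inversion_one]
    calc (dist y x₁)⁻¹ < (δ⁻¹)⁻¹ := inv_strictAnti₀ hδi hfar
      _ = δ := inv_inv δ
  have hb := abs_annularAvg_sub_le Ψ hΨc hΨ0 hΨπ hw y₀ hRpos hclose
  rw [Real.dist_eq]
  refine lt_of_le_of_lt hb ?_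
  rw [← hC]
  calc ε / (C + 1) * C < ε / (C + 1) * (C + 1) := mul_lt_mul_of_pos_left (by linarith) hε'
    _ = ε := div_mul_cancel₀ ε (by linarith)

/-! ## §4 The two-point knit -/

/-- **THE TWO-POINT KNIT.**  Let `Ψ` be an annular averaging profile (continuous, vanishing off `(1/4, 1)`, planar mass `π`) and
`adm` a class of functions on the plane such that
(ONE) every `v ∈ adm` has a continuous representative `v̄ = v` a.e. whose smooth annular averages
`(πR²)⁻¹ ∫ Ψ(‖y − x₀‖²/R²) v̄(y) dy` about every centre `x₀` converge as `R → ∞` to some `L` with `|v̄ x₀ − L| ≤ K`, and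
(INV) `adm` is invariant under the unit inversion about every centre.
Then the continuous representative of any `u ∈ adm` satisfies the TWO-POINT bound `|ū x₀ − ū x₁| ≤ K` for all `x₀, x₁`.
(Memo §2 (W-TWO): apply (ONE) to `u ∘ inversion x₁ 1` at `y₀ = inversion x₁ 1 x₀`; its representative is `ū ∘ inversion`
off `x₁`, so its value at `y₀` is `ū x₀`, and its annular averages at infinity converge to `ū x₁`.) [folklore] -/
theorem wente_twoPoint_of_oneCentre_of_inversion (Ψ : ℝ → ℝ) (hΨc : Continuous Ψ)
    (hΨ0 : ∀ t, t ≤ 1 / 4 ∨ 1 ≤ t → Ψ t = 0) (hΨπ : ∫ z : (EuclideanSpace ℝ (Fin 2)), Ψ (‖z‖ ^ 2) = π)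
    {K : ℝ} (adm : ((EuclideanSpace ℝ (Fin 2)) → ℝ) → Prop)
    (hONE : ∀ v : (EuclideanSpace ℝ (Fin 2)) → ℝ, adm v → ∃ w : (EuclideanSpace ℝ (Fin 2)) → ℝ, Continuous w ∧ w =ᵐ[volume] v ∧
      ∀ x₀ : (EuclideanSpace ℝ (Fin 2)), ∃ L : ℝ,
        Tendsto (fun R : ℝ => (π * R ^ 2)⁻¹ * ∫ y : (EuclideanSpace ℝ (Fin 2)), Ψ (‖y - x₀‖ ^ 2 / R ^ 2) * w y) atTop (𝓝 L) ∧
          |w x₀ - L| ≤ K)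
    (hINV : ∀ (v : (EuclideanSpace ℝ (Fin 2)) → ℝ) (x₁ : (EuclideanSpace ℝ (Fin 2))), adm v → adm (v ∘ fun y => inversion x₁ 1 y))
    {u : (EuclideanSpace ℝ (Fin 2)) → ℝ} (hu : adm u) :
    ∃ ū : (EuclideanSpace ℝ (Fin 2)) → ℝ, Continuous ū ∧ ū =ᵐ[volume] u ∧ ∀ x₀ x₁ : (EuclideanSpace ℝ (Fin 2)), |ū x₀ - ū x₁| ≤ K := by
  obtain ⟨ū, hūc, hūae, hūL⟩ := hONE u hu
  refine ⟨ū, hūc, hūae, fun x₀ x₁ => ?_⟩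
  -- `K` is nonnegative (from (ONE) at any centre)
  have hK : 0 ≤ K := by
    obtain ⟨L, -, hL⟩ := hūL x₀
    exact (abs_nonneg _).trans hL
  by_cases hx : x₀ = x₁
  · rw [hx, sub_self, abs_zero]; exact hK
  -- the inverted function and its representative
  have hũ : adm (u ∘ fun y => inversion x₁ 1 y) := hINV u x₁ hu
  obtain ⟨w, hwc, hwae, hwL⟩ := hONE _ hũ
  set y₀ : (EuclideanSpace ℝ (Fin 2)) := inversion x₁ 1 x₀ with hy₀_def
  have hy₀ : y₀ ≠ x₁ := inversion_ne_center hx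
  have hMy₀ : inversion x₁ 1 y₀ = x₀ := inversion_inversion_one x₁ x₀
  obtain ⟨L, hL, hbound⟩ := hwL y₀
  -- identification 1: `w = ū ∘ inversion` off the centre, so `w y₀ = ū x₀`
  have hw_ae : w =ᵐ[volume] (ū ∘ fun y => inversion x₁ 1 y) :=
    hwae.trans (ae_eq_comp_inversion_one x₁ hūae.symm)
  have heq : ∀ y : (EuclideanSpace ℝ (Fin 2)), y ≠ x₁ → w y = ū (inversion x₁ 1 y) :=
    fun y hy => eq_comp_inversion_of_ae_eq hwc hūc hw_ae hy
  have hwy₀ : w y₀ = ū x₀ := by rw [heq y₀ hy₀, hMy₀]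
  -- identification 2: the annular averages of `w` about `y₀` tend to `ū x₁`
  have hL' := tendsto_annularAvg_comp_inversion Ψ hΨc hΨ0 hΨπ hwc hūc y₀ x₁ heq
  have hLeq : L = ū x₁ := tendsto_nhds_unique hL hL'
  rw [← hwy₀, ← hLeq]
  exact hbound

/-! ## §5 From the two-point bound to the oscillation form -/

/-- A function with `|w x₀ − w x₁| ≤ K` for all pairs lies within `K/2` of the midpoint of its range. [folklore] -/
theorem exists_const_abs_sub_le_half {X : Type*} [Nonempty X] {w : X → ℝ} {K : ℝ}
    (h : ∀ x₀ x₁ : X, |w x₀ - w x₁| ≤ K) : ∃ c : ℝ, ∀ x : X, |w x - c| ≤ K / 2 := by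
  obtain ⟨z⟩ := ‹Nonempty X›
  have hab : BddAbove (range w) := by
    refine ⟨w z + K, ?_⟩
    rintro _ ⟨x, rfl⟩
    have := (abs_sub_le_iff.mp (h x z)).1
    linarith
  have hbb : BddBelow (range w) := by
    refine ⟨w z - K, ?_⟩
    rintro _ ⟨x, rfl⟩
    have := (abs_sub_le_iff.mp (h x z)).2
    linarith
  set s := ⨆ x, w x with hs
  set i := ⨅ x, w x with hi
  have hle_s : ∀ x, w x ≤ s := fun x => le_ciSup hab x
  have hi_le : ∀ x, i ≤ w x := fun x => ciInf_le hbb x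
  have hsi : s - i ≤ K := by
    have h1 : ∀ x₁, s ≤ w x₁ + K := fun x₁ =>
      ciSup_le fun x₀ => by have := (abs_sub_le_iff.mp (h x₀ x₁)).1; linarith
    have h2 : s - K ≤ i := le_ciInf fun x₁ => by have := h1 x₁; linarith
    linarith
  refine ⟨(s + i) / 2, fun x => ?_⟩
  rw [abs_sub_le_iff]
  constructor
  · have := hle_s x; linarith
  · have := hi_le x; linarith

/-- **Oscillation form, everywhere** (for the continuous representative): under (ONE) and (INV), every `u ∈ adm` has a
continuous representative `ū` and a constant `c` with `|ū x − c| ≤ K/2` for ALL `x`. [folklore] -/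
theorem wente_osc_of_oneCentre_of_inversion (Ψ : ℝ → ℝ) (hΨc : Continuous Ψ)
    (hΨ0 : ∀ t, t ≤ 1 / 4 ∨ 1 ≤ t → Ψ t = 0) (hΨπ : ∫ z : (EuclideanSpace ℝ (Fin 2)), Ψ (‖z‖ ^ 2) = π)
    {K : ℝ} (adm : ((EuclideanSpace ℝ (Fin 2)) → ℝ) → Prop)
    (hONE : ∀ v : (EuclideanSpace ℝ (Fin 2)) → ℝ, adm v → ∃ w : (EuclideanSpace ℝ (Fin 2)) → ℝ, Continuous w ∧ w =ᵐ[volume] v ∧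
      ∀ x₀ : (EuclideanSpace ℝ (Fin 2)), ∃ L : ℝ,
        Tendsto (fun R : ℝ => (π * R ^ 2)⁻¹ * ∫ y : (EuclideanSpace ℝ (Fin 2)), Ψ (‖y - x₀‖ ^ 2 / R ^ 2) * w y) atTop (𝓝 L) ∧
          |w x₀ - L| ≤ K)
    (hINV : ∀ (v : (EuclideanSpace ℝ (Fin 2)) → ℝ) (x₁ : (EuclideanSpace ℝ (Fin 2))), adm v → adm (v ∘ fun y => inversion x₁ 1 y))
    {u : (EuclideanSpace ℝ (Fin 2)) → ℝ} (hu : adm u) :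
    ∃ ū : (EuclideanSpace ℝ (Fin 2)) → ℝ, Continuous ū ∧ ū =ᵐ[volume] u ∧ ∃ c : ℝ, ∀ x : (EuclideanSpace ℝ (Fin 2)), |ū x - c| ≤ K / 2 := by
  obtain ⟨ū, hūc, hūae, htwo⟩ := wente_twoPoint_of_oneCentre_of_inversion Ψ hΨc hΨ0 hΨπ adm hONE hINV hu
  exact ⟨ū, hūc, hūae, exists_const_abs_sub_le_half htwo⟩

/-- **Oscillation form, almost everywhere** (the `hOsc` row of brick W-ALG with `K = (1/π)‖∇a‖₂‖∇b‖₂`, i.e.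
`‖u − c‖_∞ ≤ (1/2π)‖∇a‖₂‖∇b‖₂` = (W-OSC)): under (ONE) and (INV), every `u ∈ adm` satisfies `|u y − c| ≤ K/2` for a.e. `y`,
for some constant `c`. [folklore] -/
theorem wente_osc_ae_of_oneCentre_of_inversion (Ψ : ℝ → ℝ) (hΨc : Continuous Ψ)
    (hΨ0 : ∀ t, t ≤ 1 / 4 ∨ 1 ≤ t → Ψ t = 0) (hΨπ : ∫ z : (EuclideanSpace ℝ (Fin 2)), Ψ (‖z‖ ^ 2) = π)
    {K : ℝ} (adm : ((EuclideanSpace ℝ (Fin 2)) → ℝ) → Prop)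
    (hONE : ∀ v : (EuclideanSpace ℝ (Fin 2)) → ℝ, adm v → ∃ w : (EuclideanSpace ℝ (Fin 2)) → ℝ, Continuous w ∧ w =ᵐ[volume] v ∧
      ∀ x₀ : (EuclideanSpace ℝ (Fin 2)), ∃ L : ℝ,
        Tendsto (fun R : ℝ => (π * R ^ 2)⁻¹ * ∫ y : (EuclideanSpace ℝ (Fin 2)), Ψ (‖y - x₀‖ ^ 2 / R ^ 2) * w y) atTop (𝓝 L) ∧
          |w x₀ - L| ≤ K)
    (hINV : ∀ (v : (EuclideanSpace ℝ (Fin 2)) → ℝ) (x₁ : (EuclideanSpace ℝ (Fin 2))), adm v → adm (v ∘ fun y => inversion x₁ 1 y))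
    {u : (EuclideanSpace ℝ (Fin 2)) → ℝ} (hu : adm u) :
    ∃ c : ℝ, ∀ᵐ y ∂(volume : Measure (EuclideanSpace ℝ (Fin 2))), |u y - c| ≤ K / 2 := by
  obtain ⟨ū, -, hūae, c, hc⟩ := wente_osc_of_oneCentre_of_inversion Ψ hΨc hΨ0 hΨπ adm hONE hINV hu
  refine ⟨c, ?_⟩
  filter_upwards [hūae] with y hy
  rw [← hy]
  exact hc y

end Summit.QuantumFields.YangMills.Theorems.PoincareLipschitzWenteTwoPoint

end
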